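import Summits.Parity.GeneralizedHardyLittlewood.Theses.ParityWeightedChenSwitching
import Summits.Parity.GeneralizedHardyLittlewood.Theorems.ParityWeightedChenSwitchingParityChenInequality
import HarnessLib

/-!
# Route `ParityWeightedChenSwitching` — the oracle reduction as ONE kernel implication

With the crux S1 `ParityChenInequality` PROVED (`…Theorems.parityChenInequality_proof`, p543554:
`∃ c > 0, ∃ C, ∀ᶠ x, c·x/log²x − C·(E₁(x) + E₂(x)) ≤ π₂(x)`, where `E₁`, `E₂` are LITERALLY the
`ℓ¹`-over-moduli sums of the two open cruxes K1 `MoebiusShiftedPrimesLevel` and K2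
`MoebiusSwitchedHostLevel`), the route's mathematical content collapses to a single unconditional
implication, recorded here by name:

  `MoebiusShiftedPrimesLevel → MoebiusSwitchedHostLevel → TwinLowerDensity`

("if the Möbius function has level of distribution `x^0.499`, in main-term-free `ℓ¹` form, along the
shifted primes `p + 2` AND along Chen's switched host `p₁p₂p₃ − 2`, then twin primes have positive
lower density on the Hardy–Littlewood scale, `π₂(x) ≥ (c/2)·x/log²x` for all large `x`").  The proof is
the twin half of the route's deciding theorem `…Theses.ParityWeightedChenSwitching.closes` with S1
discharged: `K1, K2` give `C·(E₁ + E₂) ≤ (c/2)·x/log²x` eventually.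

Honesty label: a PARITY-ORACLE REDUCTION, not twin density.  Both hypotheses are OPEN PROBLEMS — K1
contains the folklore conjecture "μ ⟂ shifted primes" (`Literature.NumberTheory.Sieve.MoebiusShiftedPrimesConjecture`
at `h = 2`; kernel: `…Theorems.MoebiusShiftedPrimesLevel.Negative.moebiusShiftedPrimesConjecture_two_of_moebiusShiftedPrimesLevel`),
K2 its ternary analogue on the switched host; the strategist census
(`Cruxes/MoebiusShiftedPrimesLevel/STRATEGY-CENSUS.md`) records no strategy short of the summit for K1.
Supports the target item stmt-Parity-18377 `TwinLowerDensity` (it is exactly what remains to feed it).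
-/

namespace Summit.Parity.GeneralizedHardyLittlewood.Theorems

open Filter Asymptotics

/-- **Twin primes from two Möbius level statements (oracle reduction, S1 discharged).**
`MoebiusShiftedPrimesLevel → MoebiusSwitchedHostLevel → TwinLowerDensity`: if
`∑_{m ≤ x^0.499} |∑_{p ≤ x, m ∣ p+2} μ(p+2)| = o(x/log²x)` (K1) and
`∑_{m ≤ x^0.499} |∑_{e ∈ chenSetB x, m ∣ e} μ(e)| = o(x/log²x)` (K2), then
`∃ c > 0, ∃ x₀, ∀ x ≥ x₀, c·x/log²x ≤ π₂(x)`.  Proof: the PROVED parity-weighted Chen inequality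
`parityChenInequality_proof` gives `c·x/log²x − C·(E₁ + E₂) ≤ π₂(x)` eventually; K1 + K2 make
`|C·(E₁ + E₂)| ≤ (c/2)·x/log²x` eventually; the witness constant is `c/2`.  Both hypotheses are open
problems (K1 ⊇ `MoebiusShiftedPrimesConjecture` at `h = 2`); this theorem is the route's reduction, not
progress on twin primes. -/
theorem twinLowerDensity_of_moebiusShiftedPrimesLevel_of_moebiusSwitchedHostLevel
    (h₁ : Summit.Parity.GeneralizedHardyLittlewood.Theses.ParityWeightedChenSwitching.MoebiusShiftedPrimesLevel)
    (h₂ : Summit.Parity.GeneralizedHardyLittlewood.Theses.ParityWeightedChenSwitching.MoebiusSwitchedHostLevel) :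
    Summit.Parity.GeneralizedHardyLittlewood.Theses.ParityWeightedChenSwitching.TwinLowerDensity := by
  have h₃ := parityChenInequality_proof
  unfold Summit.Parity.GeneralizedHardyLittlewood.Theses.ParityWeightedChenSwitching.ParityChenInequality at h₃
  unfold Summit.Parity.GeneralizedHardyLittlewood.Theses.ParityWeightedChenSwitching.MoebiusShiftedPrimesLevel at h₁
  unfold Summit.Parity.GeneralizedHardyLittlewood.Theses.ParityWeightedChenSwitching.MoebiusSwitchedHostLevel at h₂
  unfold Summit.Parity.GeneralizedHardyLittlewood.Theses.ParityWeightedChenSwitching.TwinLowerDensity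
  obtain ⟨c, hc, C, hev⟩ := h₃
  have ho := ((h₁.add h₂).const_mul_left C).def (half_pos hc)
  obtain ⟨x₀, hx₀⟩ := Filter.eventually_atTop.mp ((hev.and ho).and (Filter.eventually_ge_atTop 2))
  refine ⟨c / 2, half_pos hc, x₀, fun x hx => ?_⟩
  obtain ⟨⟨hin, hsm⟩, hx2⟩ := hx₀ x hx
  have hx1 : (1 : ℝ) < x := by exact_mod_cast (show 1 < x by omega)
  have hlog : 0 < Real.log x := Real.log_pos hx1
  set g : ℝ := (x : ℝ) / Real.log x ^ 2 with hg_def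
  have hg : 0 ≤ g := by positivity
  rw [Real.norm_eq_abs, Real.norm_eq_abs, abs_of_nonneg hg] at hsm
  have h5 := (abs_le.mp hsm).2
  have e1 : c * (x : ℝ) / Real.log x ^ 2 = c * g := by rw [hg_def]; ring
  have e2 : c / 2 * (x : ℝ) / Real.log x ^ 2 = c / 2 * g := by rw [hg_def]; ring
  rw [e1] at hin
  have key : c / 2 * (x : ℝ) / Real.log x ^ 2 ≤
      (((Finset.range (x + 1)).filter (fun p => p.Prime ∧ (p + 2).Prime)).card : ℝ) := by
    rw [e2]; linarith
  simpa [Literature.NumberTheory.Sieve.twinPrimeCount] using key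

end Summit.Parity.GeneralizedHardyLittlewood.Theorems
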